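import Summits.QuantumAdvantage.QuantumAdvantage.Theorems.CubicForrelationNearExactIsExactWalshTower
import Summits.QuantumAdvantage.QuantumAdvantage.Theorems.CubicForrelationNearExactIsExactAxParity
import Summits.QuantumAdvantage.QuantumAdvantage.Theorems.CubicForrelationNearExactIsExactRankTwoCeilingA
import Summits.QuantumAdvantage.QuantumAdvantage.Theorems.CubicForrelationNearExactIsExactDerivDegree

/-!
# Crux `CubicForrelation.NearExactIsExact` (stmt-QuantumAdvantage-14043), line `direct-sum-amplification`, lead c6 cycle 2 (wave 3):
  stub `stub_affineForm` — a function of degree ≤ 1 is an affine character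

If `P : 𝔽₂ⁿ → 𝔽₂` has degree `≤ 1` then `(−1)^{P(x)} = (−1)^b (−1)^{c·x}` for some `c, b`.  Used by the lead to read the split hyperplane
`{x : W_g(x)/16 odd}` delivered by the landed `split_ten` (an `IsDegLeFun 1` parity pattern) as `{x : c·x = b}`.
-/

set_option linter.dupNamespace false -- D-0017: single-problem summit ⇒ `QuantumAdvantage.QuantumAdvantage` by design

noncomputable section

namespace Summit.QuantumAdvantage.QuantumAdvantage.Theorems.CubicForrelation.NearExactIsExact

open Finset
open Literature.Computability.QuantumComplexity
open Literature.Computability.QuantumComplexity.BuzetChailloux (bxor zeroVec signOf_sq)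
open Literature.Computability.QuantumComplexity.DerivativeWalsh (W)

/-- **A function of degree `≤ 1` is an affine character**: `(−1)^{P(x)} = (−1)^b · (−1)^{c·x}` for some covector `c`
and bit `b`. This is the landed `ar_affine_signForm` (first differences of a degree-`≤ 1` function are constant, so
`x ↦ (−1)^{P(0) ⊕ P(x)}` is a character of `(𝔽₂ⁿ, ⊕)`, identified via Parseval + the shift identity) with its
hypothesis "derivatives lower the degree" discharged by the landed `stub_derivDegree`, and `twist` symmetrised
(`twist_comm`). [folklore] -/
theorem stub_affineForm :
    ∀ (n : ℕ) (P : (Fin n → Bool) → Bool), IsDegLeFun 1 P →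
      ∃ (c : Fin n → Bool) (b : Bool), ∀ x, signOf (P x) = signOf b * twist c x := by
  intro n P hP
  obtain ⟨b, c, h⟩ := ar_affine_signForm stub_derivDegree hP
  exact ⟨c, b, fun x => by rw [h x, twist_comm]⟩

end Summit.QuantumAdvantage.QuantumAdvantage.Theorems.CubicForrelation.NearExactIsExact
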